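import Mathlib
import Summits.NavierStokesRegularity.NavierStokesRegularity.Theorems.TaoLadderRungTwoBreakBlowupRigidityOneUpperClock
import HarnessLib

/-!
# THE FRONT IS SHARP: before shell `k` lights, the energy above shell `k` is below the critical scale of shell `k+2`
  and the pre-lit action of shell `k` is free; the action ceiling (F2a) of the front bundle then reduces, via the energy
  bound, to a LOWER clock at the first-lit times — which the sub-unitary clock shows to be the UNITARY (wake-free) case
  — support for `stub_eternalFromBlowup` of K2(1) `TaoLadderRungTwoBreak.BlowupRigidityOne` (stmt-NavierStokesRegularity-20206)

MODEL lattice ODEs only (Tao 2016 §4 (4.3), Lemma 4.1 (4.5)–(4.10), (4.12), §6.4); nothing here is a statement about the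
Navier–Stokes equations; NO item is closed (`--supports stmt-NavierStokesRegularity-20206`). General `m`; DEF-FREE.

With `u_k = C_A T Λ^{k+1}‖x_k‖` and "unlit on `[0,s)`" = `u_k < 1/2` there (e.g. `s ≤ s_k`, the first-lit time):
* `tailEnergy_small_of_unlit` — `E₀ - Σ_{j≤k}‖x_j(s)‖² ≤ (4 C_A T Λ^{k+2})⁻²`: by energy climbing
  (`tailEnergy_le_sq_action`) the energy strictly above an unlit shell is below the critical energy scale `Λ^{-2(k+2)}` of the
  shell two above — AHEAD OF THE FRONT THERE IS NOTHING;
* `prelit_action_le` — `C_A T Λ^{k+1} ∫₀ˢ ‖x_k‖ ≤ s/2`: the pre-lit `L¹` action is free (by definition of lit);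
* `tailEnergy_at_lighting` — two-sided: at a lighting time of shell `n+1` the energy above shell `n` is pinned in
  `[c_n, c_n + (4C_A T Λ^{n+3})⁻²]`, `c_n = (2 C_A T Λ^{n+2})⁻²`;
* `action_le_of_lowerClock` — with the energy bound `‖x_k‖ ≤ √E₀` after lighting:
  `C_A T Λ^{k+1} ∫_{[0,T)} ‖x_k‖ ≤ T/2 + C_A T Λ · Λ^k (T - s) √E₀`; so a LOWER CLOCK AT THE FIRST-LIT TIMES, `Λ^k (T - s_k) ≤ C_c`,
  would give the per-shell ACTION CEILING (i) of the front bundle with `A = 1/(2C_A) + Λ C_c √E₀`.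

HONEST LABEL / DEAD END RECORDED. Against `subunitaryClock` (`Λ^k (T - s_{k+1}) ≥ 1/(C_r √E₀)`), such a lower clock pins
`T - s_k ≍ Λ^{-k}`: a UNITARY front (per-shell energy ratio `μ = 1`, no wake, no exponential precursor). A DSS front with
wake (`μ < 1`) or with an exponential left tail of its profile violates `Λ^k(T - s_k) ≤ C_c` while its action stays bounded
(the profile is integrable): the energy-bound route to (F2a) is LOSSY, and the honest (F2a) needs the AMPLITUDE CEILING
`‖x_k‖ ≤ B ν^k` after passage (the wake level), i.e. item (ii) of the bundle, exactly as recorded by `ActionSplit`. No stub,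
crux or summit is proved; rung 0.
-/

noncomputable section

-- the summit and its single sub-problem share the name (CONVENTIONS §1)
set_option linter.dupNamespace false

open Set Filter Topology MeasureTheory intervalIntegral

namespace Summit.NavierStokesRegularity.NavierStokesRegularity.Theorems

namespace BlowupRigidityOne

open Literature.Analysis.FluidPDE Literature.Analysis.FluidPDE.TaoCascade

variable {m : ℕ}

/-- **AHEAD OF THE FRONT THERE IS NOTHING.** If shell `k` is unlit on `[0,s)` (`s ∈ [0,T)`), then the energy strictly above
shell `k` at time `s` is at most `(4 C_A T Λ^{k+2})⁻²`.
[cite: Tao2016AveragedNS, §4 (4.3), Lemma 4.1 (4.8)–(4.10); §1.2 (energy is fed shell after shell)] -/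
theorem tailEnergy_small_of_unlit {ε₀ T : ℝ} (hε : 0 < ε₀) (hT : 0 < T)
    {α : Fin m → Fin m → Fin m → ℤ × ℤ × ℤ → ℝ} (hc : IsCancellingCoeff α)
    {X : Fin m → ℤ → ℝ → ℝ} {X₀ : Fin m → ℝ}
    (hder : ∀ i k, ∀ t ∈ Ico 0 T, HasDerivWithinAt (X i k) (quadTerm ε₀ α X i k t) (Ici 0) t)
    (hinit : ∀ i k, X i k 0 = if k = 0 then X₀ i else 0)
    (hlow : ∀ i k t, k < 0 → X i k t = 0)
    (hreg : ∀ T' : ℝ, T' < T → ∃ M : ℝ, ∀ t ∈ Icc 0 T', ∀ (i : Fin m) (k : ℤ),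
      (1 + (1 + ε₀) ^ ((10 : ℝ) * k)) * |X i k t| ≤ M)
    (k : ℕ) {s : ℝ} (hs : s ∈ Ico 0 T)
    (hun : ∀ r ∈ Ico 0 s, fluxConst α * T * bigLam ε₀ ^ (k + 1) * ‖shellVec X (k : ℤ) r‖ < 1 / 2) :
    (∑ i, X₀ i ^ 2) - ∑ j ∈ Finset.range (k + 1), ‖shellVec X (j : ℤ) s‖ ^ 2 ≤
      ((4 * fluxConst α * T * bigLam ε₀ ^ (k + 2)) ^ 2)⁻¹ := by
  have hL : 0 < bigLam ε₀ := bigLam_pos (by linarith)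
  have hCA : 0 ≤ fluxConst α := fluxConst_nonneg α
  have htail := tailEnergy_le_sq_action hε hc hder hinit hlow hreg k s hs
  -- continuity of `u_k` on `[0,s]`
  have hcx : ContinuousOn (fun r => shellVec X (k : ℤ) r) (Ico 0 T) := by
    have hcp : ContinuousOn (fun r => fun i => X i (k : ℤ) r) (Ico 0 T) :=
      continuousOn_pi.2 fun i r hr => ((hder i _ r hr).continuousWithinAt).mono fun x hx => hx.1
    exact (PiLp.continuous_toLp 2 (fun _ : Fin m => ℝ)).comp_continuousOn hcp
  have hsub : Icc 0 s ⊆ Ico 0 T := fun r hr => ⟨hr.1, lt_of_le_of_lt hr.2 hs.2⟩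
  have hcn : ContinuousOn (fun r => ‖shellVec X (k : ℤ) r‖) (Icc 0 s) := (hcx.mono hsub).norm
  rcases hCA.eq_or_lt with h0 | hpos
  · -- `C_A = 0`: both sides vanish
    rw [← h0, zero_mul, zero_mul] at htail
    rw [← h0]
    simpa using htail
  · set c : ℝ := fluxConst α * T * bigLam ε₀ ^ (k + 1) with hc_def
    have hc0 : 0 < c := by positivity
    have hRHS : 0 ≤ ((4 * fluxConst α * T * bigLam ε₀ ^ (k + 2)) ^ 2)⁻¹ := by positivity
    rcases eq_or_lt_of_le hs.1 with hs0 | hs0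
    · -- `s = 0`: the squared action vanishes
      rw [← hs0, intervalIntegral.integral_same, mul_zero] at htail
      rw [← hs0]
      linarith [htail]
    · -- `s > 0`: `u_k ≤ 1/2` on `[0,s]` (at `s` by continuity from the left)
      have hle : ∀ r ∈ Icc 0 s, c * ‖shellVec X (k : ℤ) r‖ ≤ 1 / 2 := by
        intro r hr
        rcases eq_or_lt_of_le hr.2 with h | h
        · rw [h]
          have hmem : s ∈ closure (Ico 0 s) := by rw [closure_Ico hs0.ne]; exact ⟨hs.1, le_rfl⟩
          have hcs : ContinuousWithinAt (fun r => c * ‖shellVec X (k : ℤ) r‖) (Ico 0 s) s :=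
            ((continuousOn_const.mul hcn) s ⟨hs.1, le_rfl⟩).mono fun x hx => ⟨hx.1, hx.2.le⟩
          exact hcs.closure_le hmem continuousWithinAt_const fun y hy => (hun y hy).le
        · exact (hun r ⟨hr.1, h⟩).le
      have hI : ∫ r in (0:ℝ)..s, ‖shellVec X (k : ℤ) r‖ ^ 2 ≤ ∫ _r in (0:ℝ)..s, (1 / (2 * c)) ^ 2 := by
        refine intervalIntegral.integral_mono_on hs.1 ?_ intervalIntegrable_const fun r hr => ?_
        · exact ((hcn.pow 2).mono (by rw [uIcc_of_le hs.1])).intervalIntegrable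
        · have h1 : ‖shellVec X (k : ℤ) r‖ ≤ 1 / (2 * c) := by
            rw [le_div_iff₀ (by positivity)]; linarith [hle r hr]
          exact pow_le_pow_left₀ (norm_nonneg _) h1 2
      rw [intervalIntegral.integral_const, smul_eq_mul, sub_zero] at hI
      have hA0 : 0 ≤ fluxConst α * bigLam ε₀ ^ k * ∫ r in (0:ℝ)..s, ‖shellVec X (k : ℤ) r‖ ^ 2 := by
        have : 0 ≤ ∫ r in (0:ℝ)..s, ‖shellVec X (k : ℤ) r‖ ^ 2 :=
          intervalIntegral.integral_nonneg hs.1 fun r _ => sq_nonneg _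
        positivity
      have hA : fluxConst α * bigLam ε₀ ^ k * ∫ r in (0:ℝ)..s, ‖shellVec X (k : ℤ) r‖ ^ 2 ≤
          (4 * fluxConst α * T * bigLam ε₀ ^ (k + 2))⁻¹ := by
        calc fluxConst α * bigLam ε₀ ^ k * ∫ r in (0:ℝ)..s, ‖shellVec X (k : ℤ) r‖ ^ 2
            ≤ fluxConst α * bigLam ε₀ ^ k * (s * (1 / (2 * c)) ^ 2) := mul_le_mul_of_nonneg_left hI (by positivity)
          _ ≤ fluxConst α * bigLam ε₀ ^ k * (T * (1 / (2 * c)) ^ 2) := by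
              refine mul_le_mul_of_nonneg_left ?_ (by positivity)
              exact mul_le_mul_of_nonneg_right hs.2.le (by positivity)
          _ = (4 * fluxConst α * T * bigLam ε₀ ^ (k + 2))⁻¹ := by
              rw [hc_def]
              field_simp
              ring
      calc (∑ i, X₀ i ^ 2) - ∑ j ∈ Finset.range (k + 1), ‖shellVec X (j : ℤ) s‖ ^ 2
          ≤ (fluxConst α * bigLam ε₀ ^ k * ∫ r in (0:ℝ)..s, ‖shellVec X (k : ℤ) r‖ ^ 2) ^ 2 := htail
        _ ≤ ((4 * fluxConst α * T * bigLam ε₀ ^ (k + 2))⁻¹) ^ 2 := pow_le_pow_left₀ hA0 hA 2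
        _ = ((4 * fluxConst α * T * bigLam ε₀ ^ (k + 2)) ^ 2)⁻¹ := by rw [inv_pow]


/-- **Unlit up to the endpoint.** If shell `k` is unlit on `[0,s)` with `0 < s < T`, then `u_k ≤ 1/2` on `[0,s]`
(continuity from the left at `s`). [cite: Tao2016AveragedNS, §4 Lemma 4.1 (4.8) (continuity of the flow)] -/
theorem le_half_on_Icc_of_unlit {ε₀ T : ℝ} {α : Fin m → Fin m → Fin m → ℤ × ℤ × ℤ → ℝ}
    {X : Fin m → ℤ → ℝ → ℝ}
    (hder : ∀ i k, ∀ t ∈ Ico 0 T, HasDerivWithinAt (X i k) (quadTerm ε₀ α X i k t) (Ici 0) t)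
    (k : ℕ) {s : ℝ} (hs : s ∈ Ico 0 T) (hs0 : 0 < s)
    (hun : ∀ r ∈ Ico 0 s, fluxConst α * T * bigLam ε₀ ^ (k + 1) * ‖shellVec X (k : ℤ) r‖ < 1 / 2) :
    ∀ r ∈ Icc 0 s, fluxConst α * T * bigLam ε₀ ^ (k + 1) * ‖shellVec X (k : ℤ) r‖ ≤ 1 / 2 := by
  have hcx : ContinuousOn (fun r => shellVec X (k : ℤ) r) (Ico 0 T) := by
    have hcp : ContinuousOn (fun r => fun i => X i (k : ℤ) r) (Ico 0 T) :=
      continuousOn_pi.2 fun i r hr => ((hder i _ r hr).continuousWithinAt).mono fun x hx => hx.1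
    exact (PiLp.continuous_toLp 2 (fun _ : Fin m => ℝ)).comp_continuousOn hcp
  have hsub : Icc 0 s ⊆ Ico 0 T := fun r hr => ⟨hr.1, lt_of_le_of_lt hr.2 hs.2⟩
  have hcn : ContinuousOn (fun r => fluxConst α * T * bigLam ε₀ ^ (k + 1) * ‖shellVec X (k : ℤ) r‖) (Icc 0 s) :=
    continuousOn_const.mul (hcx.mono hsub).norm
  intro r hr
  rcases eq_or_lt_of_le hr.2 with h | h
  · rw [h]
    have hmem : s ∈ closure (Ico 0 s) := by rw [closure_Ico hs0.ne]; exact ⟨hs.1, le_rfl⟩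
    have hcs : ContinuousWithinAt (fun r => fluxConst α * T * bigLam ε₀ ^ (k + 1) * ‖shellVec X (k : ℤ) r‖)
        (Ico 0 s) s := (hcn s ⟨hs.1, le_rfl⟩).mono fun x hx => ⟨hx.1, hx.2.le⟩
    exact hcs.closure_le hmem continuousWithinAt_const fun y hy => (hun y hy).le
  · exact (hun r ⟨hr.1, h⟩).le

/-- **THE PRE-LIT ACTION IS FREE**: `C_A T Λ^{k+1} ∫₀ˢ ‖x_k‖ ≤ s/2` if shell `k` is unlit on `[0,s)`, `s ∈ [0,T)`.
[cite: Tao2016AveragedNS, §4 Lemma 4.1 (4.8), §6.4; cell vocabulary (the `action` clause of `IsEternal`)] -/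
theorem prelit_action_le {ε₀ T : ℝ} (hε : 0 < ε₀)
    {α : Fin m → Fin m → Fin m → ℤ × ℤ × ℤ → ℝ} {X : Fin m → ℤ → ℝ → ℝ}
    (hder : ∀ i k, ∀ t ∈ Ico 0 T, HasDerivWithinAt (X i k) (quadTerm ε₀ α X i k t) (Ici 0) t)
    (k : ℕ) {s : ℝ} (hs : s ∈ Ico 0 T)
    (hun : ∀ r ∈ Ico 0 s, fluxConst α * T * bigLam ε₀ ^ (k + 1) * ‖shellVec X (k : ℤ) r‖ < 1 / 2) :
    fluxConst α * T * bigLam ε₀ ^ (k + 1) * ∫ r in (0:ℝ)..s, ‖shellVec X (k : ℤ) r‖ ≤ s / 2 := by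
  have hL : 0 < bigLam ε₀ := bigLam_pos (by linarith)
  rcases eq_or_lt_of_le hs.1 with hs0 | hs0
  · rw [← hs0, intervalIntegral.integral_same, mul_zero, zero_div]
  have hle := le_half_on_Icc_of_unlit hder k hs hs0 hun
  have hcx : ContinuousOn (fun r => shellVec X (k : ℤ) r) (Ico 0 T) := by
    have hcp : ContinuousOn (fun r => fun i => X i (k : ℤ) r) (Ico 0 T) :=
      continuousOn_pi.2 fun i r hr => ((hder i _ r hr).continuousWithinAt).mono fun x hx => hx.1
    exact (PiLp.continuous_toLp 2 (fun _ : Fin m => ℝ)).comp_continuousOn hcp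
  have hsub : Icc 0 s ⊆ Ico 0 T := fun r hr => ⟨hr.1, lt_of_le_of_lt hr.2 hs.2⟩
  have hcn : ContinuousOn (fun r => fluxConst α * T * bigLam ε₀ ^ (k + 1) * ‖shellVec X (k : ℤ) r‖) (Icc 0 s) :=
    continuousOn_const.mul (hcx.mono hsub).norm
  rw [← intervalIntegral.integral_const_mul]
  have hI : ∫ r in (0:ℝ)..s, fluxConst α * T * bigLam ε₀ ^ (k + 1) * ‖shellVec X (k : ℤ) r‖ ≤
      ∫ _r in (0:ℝ)..s, (1 / 2 : ℝ) :=
    intervalIntegral.integral_mono_on hs.1 ((hcn.mono (by rw [uIcc_of_le hs.1])).intervalIntegrable)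
      intervalIntegrable_const fun r hr => hle r hr
  rw [intervalIntegral.integral_const, smul_eq_mul, sub_zero] at hI
  linarith

/-- **THE ACTION CEILING FROM A LOWER CLOCK AT THE FIRST-LIT TIME (energy-bound route).** For a cancelling table and an
exact flow on `[0,T)` from the one-shell datum (`E₀ = Σ X₀ᵢ²`): if shell `k` is unlit on `[0,s)` (`s ∈ [0,T)`), then
`‖x_k‖` is integrable on `[0,T)` and `C_A T Λ^{k+1} ∫_{[0,T)} ‖x_k‖ ≤ s/2 + C_A T Λ^{k+1} (T - s) √E₀`; under a lower clock
`Λ^k (T - s) ≤ C_c` the right side is `≤ T/2 + C_A T Λ C_c √E₀`, uniformly in `k` (item (i) of the front bundle). See the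
module docstring for why this clock is the unitary case only.
[cite: Tao2016AveragedNS, §4 (4.3), Lemma 4.1 (4.5), (4.8)–(4.10), §6.4; cell vocabulary (the `action` clause of `IsEternal`)] -/
theorem action_le_of_lowerClock {ε₀ T : ℝ} (hε : 0 < ε₀) (hT : 0 < T)
    {α : Fin m → Fin m → Fin m → ℤ × ℤ × ℤ → ℝ} (hc : IsCancellingCoeff α)
    {X : Fin m → ℤ → ℝ → ℝ} {X₀ : Fin m → ℝ}
    (hder : ∀ i k, ∀ t ∈ Ico 0 T, HasDerivWithinAt (X i k) (quadTerm ε₀ α X i k t) (Ici 0) t)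
    (hinit : ∀ i k, X i k 0 = if k = 0 then X₀ i else 0)
    (hlow : ∀ i k t, k < 0 → X i k t = 0)
    (hreg : ∀ T' : ℝ, T' < T → ∃ M : ℝ, ∀ t ∈ Icc 0 T', ∀ (i : Fin m) (k : ℤ),
      (1 + (1 + ε₀) ^ ((10 : ℝ) * k)) * |X i k t| ≤ M)
    (k : ℕ) {s Cc : ℝ} (hs : s ∈ Ico 0 T)
    (hun : ∀ r ∈ Ico 0 s, fluxConst α * T * bigLam ε₀ ^ (k + 1) * ‖shellVec X (k : ℤ) r‖ < 1 / 2)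
    (hclock : bigLam ε₀ ^ k * (T - s) ≤ Cc) :
    IntegrableOn (fun t => ‖shellVec X (k : ℤ) t‖) (Ico 0 T) ∧
      fluxConst α * T * bigLam ε₀ ^ (k + 1) * (∫ t in Ico 0 T, ‖shellVec X (k : ℤ) t‖) ≤
        T / 2 + fluxConst α * T * bigLam ε₀ * Cc * Real.sqrt (∑ i, X₀ i ^ 2) := by
  have hL : 0 < bigLam ε₀ := bigLam_pos (by linarith)
  have hCA : 0 ≤ fluxConst α := fluxConst_nonneg α
  set D : ℝ := Real.sqrt (∑ i, X₀ i ^ 2) with hD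
  have hD0 : 0 ≤ D := Real.sqrt_nonneg _
  have hE : ∀ t ∈ Ico (0:ℝ) T, ‖shellVec X (k : ℤ) t‖ ≤ D :=
    fun t ht => norm_shellVec_le_sqrt_datumEnergy hε hc hder hinit hlow hreg (k : ℤ) t ht
  -- integrability on `[0,T)`: bounded and continuous
  have hcont : ContinuousOn (fun t => shellVec X (k : ℤ) t) (Ico 0 T) := by
    have hcp : ContinuousOn (fun r => fun i => X i (k : ℤ) r) (Ico 0 T) :=
      continuousOn_pi.2 fun i r hr => ((hder i _ r hr).continuousWithinAt).mono fun x hx => hx.1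
    exact (PiLp.continuous_toLp 2 (fun _ : Fin m => ℝ)).comp_continuousOn hcp
  have hmeas : AEStronglyMeasurable (fun t => ‖shellVec X (k : ℤ) t‖) (volume.restrict (Ico 0 T)) :=
    (hcont.norm).aestronglyMeasurable measurableSet_Ico
  have hint : IntegrableOn (fun t => ‖shellVec X (k : ℤ) t‖) (Ico 0 T) :=
    ⟨hmeas, HasFiniteIntegral.restrict_of_bounded D measure_Ico_lt_top
      ((ae_restrict_mem measurableSet_Ico).mono fun t ht => by rw [norm_norm]; exact hE t ht)⟩
  refine ⟨hint, ?_⟩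
  -- split `[0,T) = [0,s) ∪ [s,T)`
  have hsplit : ∫ t in Ico 0 T, ‖shellVec X (k : ℤ) t‖ =
      (∫ t in Ico 0 s, ‖shellVec X (k : ℤ) t‖) + ∫ t in Ico s T, ‖shellVec X (k : ℤ) t‖ := by
    rw [← Ico_union_Ico_eq_Ico hs.1 hs.2.le,
      setIntegral_union (Ico_disjoint_Ico_same) measurableSet_Ico
        (hint.mono_set (Ico_subset_Ico_right hs.2.le)) (hint.mono_set (Ico_subset_Ico_left hs.1))]
  have h1 : ∫ t in Ico 0 s, ‖shellVec X (k : ℤ) t‖ = ∫ t in (0 : ℝ)..s, ‖shellVec X (k : ℤ) t‖ := by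
    rw [intervalIntegral.integral_of_le hs.1, setIntegral_congr_set Ico_ae_eq_Ioc]
  have h2 : ∫ t in Ico s T, ‖shellVec X (k : ℤ) t‖ ≤ D * (T - s) := by
    have h := setIntegral_mono_on (hint.mono_set (Ico_subset_Ico_left hs.1))
      (integrableOn_const (measure_Ico_lt_top.ne)) measurableSet_Ico
      (fun t ht => hE t ⟨hs.1.trans ht.1, ht.2⟩) (g := fun _ => D)
    rw [setIntegral_const, smul_eq_mul, measureReal_def, Real.volume_Ico,
      ENNReal.toReal_ofReal (by linarith [hs.2])] at h
    linarith
  have hpre := prelit_action_le hε hder k hs hun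
  rw [hsplit, h1, mul_add]
  have h3 : fluxConst α * T * bigLam ε₀ ^ (k + 1) * ∫ t in Ico s T, ‖shellVec X (k : ℤ) t‖ ≤
      fluxConst α * T * bigLam ε₀ * Cc * D := by
    calc fluxConst α * T * bigLam ε₀ ^ (k + 1) * ∫ t in Ico s T, ‖shellVec X (k : ℤ) t‖
        ≤ fluxConst α * T * bigLam ε₀ ^ (k + 1) * (D * (T - s)) := mul_le_mul_of_nonneg_left h2 (by positivity)
      _ = fluxConst α * T * bigLam ε₀ * (bigLam ε₀ ^ k * (T - s)) * D := by ring
      _ ≤ fluxConst α * T * bigLam ε₀ * Cc * D := by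
          refine mul_le_mul_of_nonneg_right (mul_le_mul_of_nonneg_left hclock (by positivity)) hD0
  linarith [hs.2]


/-- **THE TAIL ENERGY IS PINNED AT A LIGHTING TIME (two-sided).** If shell `n+1` is unlit on `[0,r)` and lit at `r`
(`0 < r < T`; e.g. `r = s_{n+1}`), then `u_{n+1}(r) = 1/2` exactly and the energy strictly above shell `n` at time `r` lies in
`[c_n, c_n + (4 C_A T Λ^{n+3})⁻²]`, `c_n = (2 C_A T Λ^{n+2})⁻²`: the head carries the critical energy and nothing sits above it.
[cite: Tao2016AveragedNS, §4 (4.3), Lemma 4.1 (4.8)–(4.10); §1.2] -/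
theorem tailEnergy_at_lighting {ε₀ T : ℝ} (hε : 0 < ε₀) (hT : 0 < T)
    {α : Fin m → Fin m → Fin m → ℤ × ℤ × ℤ → ℝ} (hc : IsCancellingCoeff α)
    {X : Fin m → ℤ → ℝ → ℝ} {X₀ : Fin m → ℝ}
    (hder : ∀ i k, ∀ t ∈ Ico 0 T, HasDerivWithinAt (X i k) (quadTerm ε₀ α X i k t) (Ici 0) t)
    (hinit : ∀ i k, X i k 0 = if k = 0 then X₀ i else 0)
    (hlow : ∀ i k t, k < 0 → X i k t = 0)
    (hreg : ∀ T' : ℝ, T' < T → ∃ M : ℝ, ∀ t ∈ Icc 0 T', ∀ (i : Fin m) (k : ℤ),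
      (1 + (1 + ε₀) ^ ((10 : ℝ) * k)) * |X i k t| ≤ M)
    (n : ℕ) {r : ℝ} (hr : r ∈ Ico 0 T) (hr0 : 0 < r)
    (hun : ∀ s ∈ Ico 0 r, fluxConst α * T * bigLam ε₀ ^ (n + 1 + 1) * ‖shellVec X ((n + 1 : ℕ) : ℤ) s‖ < 1 / 2)
    (hlit : 1 / 2 ≤ fluxConst α * T * bigLam ε₀ ^ (n + 1 + 1) * ‖shellVec X ((n + 1 : ℕ) : ℤ) r‖) :
    ((2 * fluxConst α * T * bigLam ε₀ ^ (n + 2)) ^ 2)⁻¹ ≤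
        (∑ i, X₀ i ^ 2) - ∑ j ∈ Finset.range (n + 1), ‖shellVec X (j : ℤ) r‖ ^ 2 ∧
      (∑ i, X₀ i ^ 2) - ∑ j ∈ Finset.range (n + 1), ‖shellVec X (j : ℤ) r‖ ^ 2 ≤
        ((2 * fluxConst α * T * bigLam ε₀ ^ (n + 2)) ^ 2)⁻¹ + ((4 * fluxConst α * T * bigLam ε₀ ^ (n + 3)) ^ 2)⁻¹ := by
  have hL : 0 < bigLam ε₀ := bigLam_pos (by linarith)
  have hCA : 0 ≤ fluxConst α := fluxConst_nonneg α
  -- `u_{n+1}(r) = 1/2` exactly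
  have hle := le_half_on_Icc_of_unlit hder (n + 1) hr hr0 hun r ⟨hr.1, le_rfl⟩
  have heq : fluxConst α * T * bigLam ε₀ ^ (n + 1 + 1) * ‖shellVec X ((n + 1 : ℕ) : ℤ) r‖ = 1 / 2 :=
    le_antisymm hle hlit
  have hCApos : 0 < fluxConst α := by
    rcases hCA.eq_or_lt with h0 | h0
    · rw [← h0] at heq; norm_num at heq
    · exact h0
  have hsq : ‖shellVec X ((n + 1 : ℕ) : ℤ) r‖ ^ 2 = ((2 * fluxConst α * T * bigLam ε₀ ^ (n + 2)) ^ 2)⁻¹ := by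
    have hne : 2 * fluxConst α * T * bigLam ε₀ ^ (n + 2) ≠ 0 := by positivity
    have h1 : ‖shellVec X ((n + 1 : ℕ) : ℤ) r‖ = (2 * fluxConst α * T * bigLam ε₀ ^ (n + 2))⁻¹ := by
      rw [show n + 2 = n + 1 + 1 by ring]
      field_simp
      linarith [heq]
    rw [h1, inv_pow]
  -- split the tail above `n` into shell `n+1` and the tail above `n+1`
  have hsplit : (∑ i, X₀ i ^ 2) - ∑ j ∈ Finset.range (n + 1), ‖shellVec X (j : ℤ) r‖ ^ 2 =
      ‖shellVec X ((n + 1 : ℕ) : ℤ) r‖ ^ 2 +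
        ((∑ i, X₀ i ^ 2) - ∑ j ∈ Finset.range (n + 1 + 1), ‖shellVec X (j : ℤ) r‖ ^ 2) := by
    rw [Finset.sum_range_succ _ (n + 1)]
    ring
  have htail := tailEnergy_small_of_unlit hε hT hc hder hinit hlow hreg (n + 1) hr hun
  have htail0 : 0 ≤ (∑ i, X₀ i ^ 2) - ∑ j ∈ Finset.range (n + 1 + 1), ‖shellVec X (j : ℤ) r‖ ^ 2 := by
    have hE := partialEnergy_le_datumEnergy hε hc hder hinit hlow hreg r hr (n + 1)
    linarith
  rw [show n + 1 + 2 = n + 3 by ring] at htail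
  refine ⟨?_, ?_⟩
  · rw [hsplit, hsq]; linarith
  · rw [hsplit, hsq]; linarith

end BlowupRigidityOne

end Summit.NavierStokesRegularity.NavierStokesRegularity.Theorems

end
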